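import Mathlib
import Literature.NumberTheory.Transcendental.AxDerivationTools

/-!
# Crux `InverseLandauRationalCurves`, line `Sketch` — stub C: constants of `d/dϖ` are algebraic

Item stmt-KontsevichZagierPeriods-13872, stub `stub_constantsAlgebraic`: on an algebraic
extension `K ⊇ k(ϖ)` (characteristic zero), every constant of a `k`-derivation `D` with
`Dϖ = 1` is algebraic over `k`.

Proof (transcendence degree one + derivations kill algebraic elements): `{ϖ}` is a
transcendence basis of `K/k`; if `x` were transcendental over `k`, then `{x}` would be a
transcendence basis as well (an algebraically independent family of cardinality `trdeg`), so
`ϖ` would be algebraic over `k(x)`; but `D` vanishes on `k(x)` (as `Dx = 0`), hence at every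
element algebraic over `k(x)` (characteristic zero), forcing `Dϖ = 0 ≠ 1`.
-/

noncomputable section

open Polynomial
open Literature.NumberTheory.Transcendental

namespace Summit.KontsevichZagierPeriods.InverseLandau.RationalCurves

section TranscendenceBasis

variable {k : Type*} [Field k]

/-- `ϖ = X` is a (one-element) transcendence basis of `k(ϖ) = RatFunc k` over `k`. -/
theorem isTranscendenceBasis_ratFunc_X (ι : Type*) [Nonempty ι] [Subsingleton ι] :
    IsTranscendenceBasis k fun _ : ι => (RatFunc.X : RatFunc k) := by
  haveI : Algebra.IsAlgebraic k[X] (RatFunc k) :=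
    IsLocalization.isAlgebraic (M := nonZeroDivisors k[X]) (S := RatFunc k)
  have h := (IsTranscendenceBasis.polynomial ι k).algebraMap_comp (A := RatFunc k)
  simp only [Function.comp_def, RatFunc.algebraMap_X] at h
  exact h

variable {K : Type*} [Field K] [Algebra k K] [Algebra (RatFunc k) K] [IsScalarTower k (RatFunc k) K]

/-- On an algebraic extension `K ⊇ k(ϖ)`, the image of `ϖ` is a (one-element) transcendence
basis of `K` over `k`. -/
theorem isTranscendenceBasis_algebraMap_X [Algebra.IsAlgebraic (RatFunc k) K]
    (ι : Type*) [Nonempty ι] [Subsingleton ι] :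
    IsTranscendenceBasis k fun _ : ι => algebraMap (RatFunc k) K RatFunc.X := by
  haveI : FaithfulSMul (RatFunc k) K :=
    (faithfulSMul_iff_algebraMap_injective _ _).mpr (algebraMap (RatFunc k) K).injective
  exact (isTranscendenceBasis_ratFunc_X ι).algebraMap_comp (A := K)

end TranscendenceBasis

/-- **Constants are algebraic.** If `K ⊇ k(ϖ)` is algebraic and `D` is a `k`-derivation of `K`
with `Dϖ = 1`, then every `x` with `Dx = 0` is algebraic over `k`: otherwise `{x}` would be a
transcendence basis of `K/k` (transcendence degree one), `ϖ` would be algebraic over `k(x)`,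
and `D`, which vanishes on `k(x)`, would vanish at `ϖ` (characteristic zero). -/
theorem stub_constantsAlgebraic
    {k K : Type*} [Field k] [CharZero k] [Field K] [Algebra k K] [Algebra (RatFunc k) K]
    [IsScalarTower k (RatFunc k) K] [Algebra.IsAlgebraic (RatFunc k) K]
    (D : Derivation k K K) (hD : D (algebraMap (RatFunc k) K RatFunc.X) = 1)
    {x : K} (hx : D x = 0) : IsAlgebraic k x := by
  by_contra hxt
  set ϖ : K := algebraMap (RatFunc k) K RatFunc.X
  -- `{ϖ}` and then `{x}` are transcendence bases of `K/k`
  have hT : IsTranscendenceBasis k fun _ : Unit => ϖ := isTranscendenceBasis_algebraMap_X Unit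
  have hind : AlgebraicIndependent k fun _ : Unit => x :=
    algebraicIndependent_unique_type_iff.mpr hxt
  have hTx : IsTranscendenceBasis k fun _ : Unit => x :=
    hind.isTranscendenceBasis_of_lift_trdeg_le_of_finite hT.lift_cardinalMk_eq_trdeg.ge
  have halg : Algebra.IsAlgebraic (Algebra.adjoin k ({x} : Set K)) K := by
    have h := hTx.isAlgebraic
    rwa [Set.range_const] at h
  -- `ϖ` is algebraic over the field `k(x)`, on which `D` vanishes
  haveI : CharZero K := charZero_of_injective_algebraMap (algebraMap k K).injective
  have hϖalg : IsAlgebraic (IntermediateField.adjoin k ({x} : Set K)) ϖ :=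
    IntermediateField.isAlgebraic_adjoin_iff.mpr (halg.isAlgebraic ϖ)
  have hF : ∀ c : IntermediateField.adjoin k ({x} : Set K),
      D (algebraMap (IntermediateField.adjoin k ({x} : Set K)) K c) = 0 := fun c =>
    derivation_eq_zero_on_adjoin (F := k) D (fun a => D.map_algebraMap a)
      (S := ({x} : Set K)) (fun s hs => by rw [Set.mem_singleton_iff.mp hs]; exact hx) c.2
  have h0 : D ϖ = 0 := derivation_eq_zero_of_isAlgebraic D hF hϖalg
  rw [hD] at h0
  exact one_ne_zero h0

end Summit.KontsevichZagierPeriods.InverseLandau.RationalCurves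

end
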